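import Mathlib.RepresentationTheory.Homological.ContCohomology.Functoriality
import Mathlib.Topology.CompactOpen
import HarnessLib

/-!
# Inner automorphisms act trivially on continuous cohomology in degree two

Generic infrastructure over Mathlib's `continuousCohomology` (homogeneous continuous cochains).
For a LOCALLY COMPACT topological group `G`, a topological `k[G]`-module `X : TopRep k G` and
`τ ∈ G`, the endomorphism of `H²(G, X)` induced by the compatible pair
`(g ↦ τ⁻¹ g τ, m ↦ τ • m)` is the IDENTITY (`map_two_eq_id_of_inner`).  Source of the statement:
J.-P. Serre, *Corps locaux* VII §5 Prop. 3 / *Cohomologie galoisienne* I §2.4–2.5 (the conjugation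
action of `G` on `H^q(G, A)` is trivial) [cite: SerreGaloisCohomology1997, I §2.5]; the tree's
`Literature/NumberTheory/EllipticCurves/Sha.lean` proves the degree-ONE case for discrete `X`
(`map_conj_one_eq_id`); here degree two, for arbitrary topological coefficients, by the explicit
prism homotopy on homogeneous cochains: for a `2`-cocycle `F`,
`F(xτ, yτ, zτ) − F(x, y, z) = (d h)(x, y, z)` with `h(a, b) := F(a, aτ, bτ) − F(a, b, bτ)`
(`exists_homotopy_two`; continuity of `h` uses local compactness of `G` through Mathlib's
curry/uncurry and the continuity of evaluation).  All declarations are theorems (no data is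
introduced): the pair `(φ, u)` is taken as a parameter with the hypotheses `φ g = τ⁻¹ g τ`,
`u m = τ • m`.

Consumer (cell abc-iut, layer L4): with `G := Δ_X`, `X := Λ` (trivial coefficients) this gives
"inner automorphisms of `Δ_X` act trivially on `H²(Δ_X, Λ)`", whence the `Π_X`-action on the REAL
cyclotome `M_X(Λ) = Hom(H²(Δ_X, Λ), Λ)` of abc-iut-L4-t1 factors through `G_k`
(`AbsTopIII/GeometricCyclotomeInnerProofs.lean`).
-/

noncomputable section

open CategoryTheory TopRep ContRepresentation Topology

namespace ContinuousCohomology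

universe u v w

variable {k : Type u} [Ring k] [TopologicalSpace k]
variable {G : Type v} [Group G] [TopologicalSpace G] [IsTopologicalGroup G]
variable (X : TopRep.{max v w} k G)

/-! ### Formulas -/

/-- `(d² F)(x)(y)(z)(w) = F y z w − (F x z w − (F x y w − F x y z))`.
[cite: SerreGaloisCohomology1997, I §2.2] -/
theorem d_three_apply (F : C(G, C(G, C(G, X)))) (x y z w : G) :
    (d X 3).hom F x y z w = F y z w - (F x z w - (F x y w - F x y z)) := rfl

/-- A compatible pair `(φ, u)` acts on homogeneous `2`-cochains by
`F ↦ ((x, y, z) ↦ u (F (φ x) (φ y) (φ z)))`. [cite: SerreGaloisCohomology1997, I §2.4] -/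
theorem cochainsMap_f_two_apply {H : Type v} [Group H] [TopologicalSpace H] [IsTopologicalGroup H]
    (φ : H →ₜ* G) {Y : TopRep.{max v w} k H} (u : res (φ : H →* G) X ⟶ Y)
    (σ : (homogeneousCochains X).X 2) (x y z : H) :
    (((cochainsMap φ u).f 2).hom σ).1 x y z = u.hom (σ.1 (φ x) (φ y) (φ z)) := rfl

/-- Homogeneity of a `2`-cochain, evaluated: `g • F (g⁻¹ x) (g⁻¹ y) (g⁻¹ z) = F x y z`.
[cite: SerreGaloisCohomology1997, I §2.2] -/
theorem invariant_three_apply (F : (homogeneousCochains X).X 2) (g x y z : G) :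
    X.ρ g (F.1 (g⁻¹ * x) (g⁻¹ * y) (g⁻¹ * z)) = F.1 x y z :=
  DFunLike.congr_fun (DFunLike.congr_fun (DFunLike.congr_fun (F.2 g) x) y) z

/-- The `2`-cocycle identity, evaluated: `F y z w − F x z w + F x y w − F x y z = 0` for
`d² F = 0`. [cite: SerreGaloisCohomology1997, I §2.2] -/
theorem cocycle_two_eq (F : (homogeneousCochains X).X 2)
    (hF : ((homogeneousCochains X).d 2 3).hom F = 0) (x y z w : G) :
    F.1 y z w - (F.1 x z w - (F.1 x y w - F.1 x y z)) = 0 := by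
  have h := congr($(hF).1 x y z w)
  rw [homogeneousCochains.d_apply] at h
  exact h

/-! ### The degree-two prism homotopy -/

/-- **The prism homotopy exists** (as an invariant continuous `1`-cochain): for `G` locally
compact, every homogeneous `2`-cochain `F` and every `τ ∈ G`, there is an invariant `1`-cochain `h`
with `h a b = F a (a τ) (b τ) − F a b (b τ)`. [cite: SerreGaloisCohomology1997, I §2.5] -/
theorem exists_homotopyCochain_two [LocallyCompactSpace G] (τ : G)
    (F : (homogeneousCochains X).X 2) :
    ∃ h : (homogeneousCochains X).X 1, ∀ a b : G, h.1 a b = F.1 a (a * τ) (b * τ) - F.1 a b (b * τ) := by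
  -- the two summands as continuous maps `G → C(G, X)`
  -- (1) `a ↦ (b ↦ F a (aτ) (bτ))` : evaluation `C(G, C(G, X)) × G → C(G, X)` is continuous
  --     (locally compact `G`), then precompose with right multiplication by `τ`
  have hev : Continuous fun p : C(G, C(G, X)) × G => p.1 p.2 := continuous_eval
  let F₁ : C(G, C(G, X)) :=
    ⟨fun a => (F.1 a (a * τ)).comp (ContinuousMap.mulRight τ),
      (ContinuousMap.continuous_precomp (ContinuousMap.mulRight τ)).comp
        (hev.comp (F.1.continuous.prodMk (continuous_mul_const τ)))⟩
  -- (2) `a ↦ (b ↦ F a b (bτ))` : uncurry `F a`, precompose with `b ↦ (b, bτ)`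
  let δ : C(G, G × G) := ⟨fun b => (b, b * τ), continuous_id.prodMk (continuous_mul_const τ)⟩
  let F₂ : C(G, C(G, X)) :=
    ⟨fun a => (F.1 a).uncurry.comp δ,
      (ContinuousMap.continuous_precomp δ).comp
        (ContinuousMap.continuous_uncurry.comp F.1.continuous)⟩
  refine ⟨⟨F₁ - F₂, fun g => ?_⟩, fun a b => rfl⟩
  ext a b
  change X.ρ g (F.1 (g⁻¹ * a) (g⁻¹ * a * τ) (g⁻¹ * b * τ) - F.1 (g⁻¹ * a) (g⁻¹ * b) (g⁻¹ * b * τ)) =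
    F.1 a (a * τ) (b * τ) - F.1 a b (b * τ)
  rw [map_sub, mul_assoc, mul_assoc, invariant_three_apply, invariant_three_apply]

/-- **The prism identity**: for a `2`-COCYCLE `F` and the homotopy cochain `h` of
`exists_homotopyCochain_two`, `F (xτ) (yτ) (zτ) = F x y z + (d h)(x)(y)(z)`.
[cite: SerreGaloisCohomology1997, I §2.5] -/
theorem prism_two (τ : G) (F : (homogeneousCochains X).X 2)
    (hF : ((homogeneousCochains X).d 2 3).hom F = 0) (h : (homogeneousCochains X).X 1)
    (hh : ∀ a b : G, h.1 a b = F.1 a (a * τ) (b * τ) - F.1 a b (b * τ)) (x y z : G) :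
    F.1 (x * τ) (y * τ) (z * τ) = F.1 x y z + (h.1 y z - (h.1 x z - h.1 x y)) := by
  rw [hh, hh, hh]
  have h1 := cocycle_two_eq X F hF x y (y * τ) (z * τ)
  have h2 := cocycle_two_eq X F hF x (x * τ) (y * τ) (z * τ)
  have h3 := cocycle_two_eq X F hF x y z (z * τ)
  rw [← sub_eq_zero]
  have key : (F.1 (x * τ) (y * τ) (z * τ) - (F.1 x y z + (F.1 y (y * τ) (z * τ) - F.1 y z (z * τ) -
      (F.1 x (x * τ) (z * τ) - F.1 x z (z * τ) - (F.1 x (x * τ) (y * τ) - F.1 x y (y * τ)))))) =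
      -(F.1 (x * τ) (y * τ) (z * τ) - (F.1 x (y * τ) (z * τ) -
          (F.1 x (x * τ) (z * τ) - F.1 x (x * τ) (y * τ))))
        - (F.1 y (y * τ) (z * τ) - (F.1 x (y * τ) (z * τ) - (F.1 x y (z * τ) - F.1 x y (y * τ))))
        + (F.1 y z (z * τ) - (F.1 x z (z * τ) - (F.1 x y (z * τ) - F.1 x y z)))
        + 2 • (F.1 (x * τ) (y * τ) (z * τ) - (F.1 x (y * τ) (z * τ) -
          (F.1 x (x * τ) (z * τ) - F.1 x (x * τ) (y * τ)))) := by
    abel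
  rw [key, h1, h2, h3]
  simp

/-! ### The theorem -/

/-- `iCycles` is injective on points in every degree (a monomorphism of topological modules; the
forgetful functor to modules preserves monomorphisms). [cite: SerreGaloisCohomology1997, I §2.2] -/
theorem cocycles_ext' (n : ℕ) {z z' : (homogeneousCochains X).cycles n}
    (h : ((homogeneousCochains X).iCycles n).hom z = ((homogeneousCochains X).iCycles n).hom z') :
    z = z' := by
  have hm : Mono ((forget₂ (TopModuleCat k) (ModuleCat k)).map ((homogeneousCochains X).iCycles n)) :=
    inferInstance
  exact (ModuleCat.mono_iff_injective _).mp hm h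

/-- On `2`-cocycles, an inner compatible pair `(φ = τ⁻¹(·)τ, u = τ•)` acts as
`z ↦ z + d(h)` for the prism homotopy `h`. [cite: SerreGaloisCohomology1997, I §2.5] -/
theorem cocyclesMap_inner_two [LocallyCompactSpace G] (τ : G) (φ : G →ₜ* G)
    (hφ : ∀ g, φ g = τ⁻¹ * g * τ) (u : res (φ : G →* G) X ⟶ X) (hu : ∀ m, u.hom m = X.ρ τ m)
    (z : (homogeneousCochains X).cycles 2) :
    ∃ h : (homogeneousCochains X).X 1,
      (cocyclesMap φ u 2).hom z = z + ((homogeneousCochains X).toCycles 1 2).hom h := by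
  have hF : ((homogeneousCochains X).d 2 3).hom (((homogeneousCochains X).iCycles 2).hom z) = 0 := by
    have e3 := congrArg (fun f => f.hom z) ((homogeneousCochains X).iCycles_d 2 3)
    simpa only [TopModuleCat.hom_comp, ContinuousLinearMap.coe_comp, Function.comp_apply,
      TopModuleCat.hom_zero, zero_apply] using e3
  obtain ⟨h, hh⟩ := exists_homotopyCochain_two X τ (((homogeneousCochains X).iCycles 2).hom z)
  refine ⟨h, cocycles_ext' X 2 ?_⟩
  have e1 := congrArg (fun f => f.hom z) (HomologicalComplex.cyclesMap_i (cochainsMap φ u) 2)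
  have e2 := congrArg (fun f => f.hom h) ((homogeneousCochains X).toCycles_i 1 2)
  simp only [TopModuleCat.hom_comp, ContinuousLinearMap.coe_comp, Function.comp_apply] at e1 e2
  change ((homogeneousCochains X).iCycles 2).hom
      ((HomologicalComplex.cyclesMap (cochainsMap φ u) 2).hom z) = _
  rw [map_add, e1, e2]
  -- now a statement about cochains: `(ψ.f 2) F = F + d h`
  apply Subtype.ext
  -- the sum in `C²(G, X)` is computed in the invariant submodule: unfold it to the ambient sum
  change (((cochainsMap φ u).f 2).hom (((homogeneousCochains X).iCycles 2).hom z)).1 =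
    (((homogeneousCochains X).iCycles 2).hom z).1 + (((homogeneousCochains X).d 1 2).hom h).1
  refine Eq.trans ?_ (congrArg
    (fun Φ => (((homogeneousCochains X).iCycles 2).hom z).1 + Φ) (homogeneousCochains.d_apply X 1 h)).symm
  ext x y w
  rw [cochainsMap_f_two_apply, ContinuousMap.add_apply, ContinuousMap.add_apply,
    ContinuousMap.add_apply, hu, hφ, hφ, hφ]
  have e4 : X.ρ τ ((((homogeneousCochains X).iCycles 2).hom z).1 (τ⁻¹ * x * τ) (τ⁻¹ * y * τ)
      (τ⁻¹ * w * τ)) = (((homogeneousCochains X).iCycles 2).hom z).1 (x * τ) (y * τ) (w * τ) := by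
    simpa only [mul_assoc] using
      invariant_three_apply X (((homogeneousCochains X).iCycles 2).hom z) τ (x * τ) (y * τ) (w * τ)
  rw [e4, prism_two X τ _ hF h hh x y w]
  rfl

/-- **Inner automorphisms act trivially on `H²`.**  For a locally compact topological group `G`, a
topological `k[G]`-module `X` and `τ ∈ G`, the endomorphism of `H²(G, X)` (Mathlib continuous
cohomology) induced by any compatible pair `(φ, u)` with `φ g = τ⁻¹ g τ` and `u m = τ • m` is the
identity. [cite: SerreGaloisCohomology1997, I §2.5] -/
theorem map_two_eq_id_of_inner [LocallyCompactSpace G] (τ : G) (φ : G →ₜ* G)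
    (hφ : ∀ g, φ g = τ⁻¹ * g * τ) (u : res (φ : G →* G) X ⟶ X) (hu : ∀ m, u.hom m = X.ρ τ m) :
    ContinuousCohomology.map φ u 2 = 𝟙 _ := by
  rw [← cancel_epi (ContinuousCohomology.π X 2), ContinuousCohomology.π_map, Category.comp_id]
  refine ConcreteCategory.hom_ext _ _ fun z => ?_
  change ((homogeneousCochains X).homologyπ 2).hom ((cocyclesMap φ u 2).hom z) =
    ((homogeneousCochains X).homologyπ 2).hom z
  obtain ⟨h, hz⟩ := cocyclesMap_inner_two X τ φ hφ u hu z
  rw [hz, map_add]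
  have e4 := congrArg (fun f => f.hom h) ((homogeneousCochains X).toCycles_comp_homologyπ 1 2)
  simp only [TopModuleCat.hom_comp, ContinuousLinearMap.coe_comp, Function.comp_apply,
    TopModuleCat.hom_zero, zero_apply] at e4
  rw [e4, add_zero]

end ContinuousCohomology
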